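import Literature.AlgebraicGeometry.GroupSchemes.SubgroupSchemeFunctorOfPoints
import Literature.AlgebraicGeometry.GroupSchemes.GroupObjectOfPointwiseLaws
import Literature.AlgebraicGeometry.GroupSchemes.BarsottiTateGroupBaseChange
import HarnessLib

/-!
# A subgroup ideal `I` of `G ×_S T` makes `Z_I → T` a closed subgroup SCHEME of `G_T` (group object + homomorphic inclusion)

Layer `Literature/AlgebraicGeometry/GroupSchemes`, namespace `Literature.AlgebraicGeometry.GroupSchemes`.  THEOREMS ONLY (no
definition, no instance, no notation, no named fact, no `sorry`).  Cell `hodgecm-mathlib` (D-0151), programme P6 «MOD», GENERIC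
ORGAN L5.3, file 4 of the road ★ `SubgroupSchemeFunctorOfPoints` (p844361) → ★ `SubgroupSchemeModuliClosed` (p844387); B-p04 (g36);
kit `F0/P6-kit/IwahoriLevel.desk` of A-p07 (g17) (whose carrier `SubgroupSchemeDatum` = «`C : Over S` with a `GrpObj` structure and a
homomorphic closed immersion `j : C ⟶ G`» is exactly what this file PRODUCES from the ideal-currency point).  Count-neutral
Mathlib-side capital: HC_CM is proved only modulo the 7 printed citations until rung 0 closes; nothing here bears on it.

[SGA3] Exp. I 2.3.3 ∕ [MumfordFogartyKirwan1994] Ch. 0 §1 (p. 2): a group structure on the functor of points is a group-object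
structure; [GortzWedhorn2020] Def. 4.42 ∕ (4.15): subgroup schemes, base change of group schemes.  ★ `IsSubgroupIdeal G T I`
(file 1) says that the points of the closed subscheme `Z_I ⊂ G ×_S T` over every `t : W ⟶ T` form a subgroup of `G(W)`.  THIS FILE
turns that into the HONEST structure: the `T`-scheme `Z_I → T` (`Over.mk (Z_I ↪ G ×_S T → T)`) carries a group-scheme structure
for which the closed immersion `Z_I ↪ G_T := G ×_S T` (Mathlib `(Over.pullback (T → S)).obj G` with its transported structure
`Functor.grpObjObj`, scoped instance `CategoryTheory.Obj`) is a HOMOMORPHISM of `T`-group schemes.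

* §1 (any cartesian monoidal category) **`exists_grpObj_isMonHom_of_lifts`** — a monomorphism `j : U ⟶ X` into a group object
  through which the multiplication, the unit and the inversion of `X` LIFT (`m_U ≫ j = (j ⊗ j) ≫ μ`, `e_U ≫ j = η`, `i_U ≫ j = j ≫ ι`)
  makes `U` a group object with exactly these structure morphisms and `j` a homomorphism (the four axioms hold on `T`-points
  after `j`, ★ `exists_grpObj_of_pointwise`);
* §2 (schemes) the three lifts for `Z_I ↪ G_T` out of `IsSubgroupIdeal G T I` — unit from `one_mem`, inversion from `inv_mem` at
  the tautological point, multiplication from `mul_mem` at the two projections of `Z_I ×_T Z_I` — through the closed immersion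
  (Mathlib `IsClosedImmersion.lift`), compared with the transported structure of `G_T` on the two projections of `G ×_S T`
  (★ `one_pullback_obj_left_comp_fst`, ★ `mul_pullback_obj_left_comp_fst`, and `ι[G_T] = (G_T → G)^*ι[G]`);
* §3 **`exists_grpObj_isMonHom_of_isSubgroupIdeal`** — the closed subgroup scheme `Z_I ≤ G_T` over `T`.

## References
* [SGA3] M. Demazure, A. Grothendieck, *Schémas en groupes I*, Exp. I, 2.3.3.
* [MumfordFogartyKirwan1994] D. Mumford, J. Fogarty, F. Kirwan, *Geometric Invariant Theory*, 3rd ed. (1994), Ch. 0 §1 (p. 2).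
* [GortzWedhorn2020] U. Görtz, T. Wedhorn, *Algebraic Geometry I*, 2nd ed. (2020), Def. 4.42, (4.15) (pp. 116–117); (4.7) (pp. 107–108).
* [Liu2021] Y. Liu, *Fourier–Jacobi cycles and arithmetic relative trace formula*, Camb. J. Math. 9 (2021), App. D p. 137 L7–11.
-/

noncomputable section

-- Mathlib's `Over`/pull-back API is stated across semireducible wrappers (as in the ★ `GroupSchemes/*` files).
set_option backward.isDefEq.respectTransparency false

open CategoryTheory CategoryTheory.Limits AlgebraicGeometry MonoidalCategory CartesianMonoidalCategory
open scoped MonObj CategoryTheory.Obj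

universe v u

namespace Literature.AlgebraicGeometry.GroupSchemes

/-! ## §1 A monomorphism through which the group structure lifts is a subgroup object -/

section Lifts

variable {C : Type u} [Category.{v} C] [CartesianMonoidalCategory C] {U X : C} [GrpObj X]

/-- **Subgroup objects from lifted structure morphisms** ([SGA3] I 2.3.3): let `j : U ⟶ X` be a monomorphism into a group object and
`m_U`, `e_U`, `i_U` lifts of the multiplication, unit and inversion of `X` through `j`.  Then `U` carries a group-object structure with
`μ = m_U`, `η = e_U`, `ι = i_U`, for which `j` is a homomorphism.  (On `T`-points, `a ↦ a ≫ j` embeds `U(T)` into the group `X(T)`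
multiplicatively, so the four group axioms of ★ `exists_grpObj_of_pointwise` hold after cancelling `j`.)
[cite: MumfordFogartyKirwan1994, Ch. 0 §1 (p. 2)] [cite: GortzWedhorn2020, Definition 4.42 and (4.15), pp. 116–117] -/
theorem exists_grpObj_isMonHom_of_lifts (j : U ⟶ X) [Mono j] (mU : U ⊗ U ⟶ U) (hm : mU ≫ j = (j ⊗ₘ j) ≫ μ[X])
    (eU : 𝟙_ C ⟶ U) (he : eU ≫ j = η[X]) (iU : U ⟶ U) (hi : iU ≫ j = j ≫ ι[X]) :
    ∃ GU : GrpObj U, @MonObj.mul C _ _ U GU.toMonObj = mU ∧ @MonObj.one C _ _ U GU.toMonObj = eU ∧ @GrpObj.inv C _ _ U GU = iU ∧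
      (letI := GU; IsMonHom j) := by
  -- the point operations of `U` read in the group `X(T)` through `j`
  have hmul : ∀ {T : C} (a b : T ⟶ U), (lift a b ≫ mU) ≫ j = (a ≫ j) * (b ≫ j) := fun a b => by
    rw [Category.assoc, hm, ← Category.assoc, lift_map, Hom.mul_def]
  have hone : ∀ {T : C}, (toUnit T ≫ eU) ≫ j = (1 : T ⟶ X) := fun {T} => by
    rw [Category.assoc, he, Hom.one_def]
  have hinv : ∀ {T : C} (a : T ⟶ U), (a ≫ iU) ≫ j = (a ≫ j)⁻¹ := fun a => by
    rw [Category.assoc, hi, ← Category.assoc, Hom.inv_def]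
  obtain ⟨GU, hμ, hη, hι⟩ := exists_grpObj_of_pointwise mU eU iU
    (fun a b c => by
      rw [← cancel_mono j, hmul, hmul, hmul, hmul, mul_assoc])
    (fun a => by rw [← cancel_mono j, hmul, hone, one_mul])
    (fun a => by rw [← cancel_mono j, hmul, hone, mul_one])
    (fun a => by rw [← cancel_mono j, hmul, hinv, hone, inv_mul_cancel])
  refine ⟨GU, hμ, hη, hι, ?_⟩
  letI := GU
  exact { one_hom := by rw [hη, he], mul_hom := by rw [hμ, hm] }

end Lifts

/-! ## §2 The three lifts for `Z_I ↪ G_T` -/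

section Scheme

variable {S : Scheme.{u}} {G T : Over S} [GrpObj G] {I : (G ⊗ T).left.IdealSheafData}

/-- The inversion of the transported group structure on `G_T = G ×_S T` is the base change of the inversion of `G`: on underlying
schemes it commutes with the projection to `G` (Mathlib `Functor.grpObjObj`: `ι[(T → S)^*G] = (T → S)^*ι[G]`, `pullback.lift_fst`).
[cite: GortzWedhorn2020, Section (4.7) (pp. 107–108)] -/
theorem inv_pullback_obj_left_comp_fst {S' : Scheme.{u}} (g : S' ⟶ S) (X : Over S) [GrpObj X] :
    ι[(Over.pullback g).obj X].left ≫ pullback.fst X.hom g = pullback.fst X.hom g ≫ ι[X].left := by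
  have h : ((Over.pullback g).map ι[X]).left ≫ pullback.fst X.hom g = pullback.fst X.hom g ≫ ι[X].left :=
    pullback.lift_fst _ _ _
  exact h

/-- **The unit lifts**: `one_mem` at `𝟙 T` gives `e : T → Z_I` with `e ≫ (Z_I ↪ G ×_S T) = (1, 𝟙_T)`, and `(1, 𝟙_T)` is the unit section
of the transported structure on `G_T` (★ `one_pullback_obj_left_comp_fst` on the first projection, `Over.w` on the second).
[cite: GortzWedhorn2020, Definition 4.42 and (4.15), pp. 116–117] -/
theorem exists_one_lift_of_isSubgroupIdeal (hI : IsSubgroupIdeal G T I) :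
    ∃ e : T.left ⟶ I.subscheme, e ≫ I.subschemeι = η[(Over.pullback T.hom).obj G].left := by
  have h1 : I.subschemeι.ker ≤ (lift (1 : T ⟶ G) (𝟙 T)).left.ker := by
    rw [Scheme.IdealSheafData.ker_subschemeι]
    exact hI.one_mem (𝟙 T)
  refine ⟨IsClosedImmersion.lift I.subschemeι (lift (1 : T ⟶ G) (𝟙 T)).left h1, ?_⟩
  rw [IsClosedImmersion.lift_fac]
  apply pullback.hom_ext
  · rw [one_pullback_obj_left_comp_fst]
    change (lift (1 : T ⟶ G) (𝟙 T)).left ≫ (fst G T).left = _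
    rw [← Over.comp_left, lift_fst, Hom.one_def, Over.comp_left, Over.toUnit_left]
  · have hw : η[(Over.pullback T.hom).obj G].left ≫ pullback.snd G.hom T.hom = 𝟙 T.left :=
      Over.w η[(Over.pullback T.hom).obj G]
    rw [hw]
    change (lift (1 : T ⟶ G) (𝟙 T)).left ≫ (snd G T).left = _
    rw [← Over.comp_left, lift_snd, Over.id_left]

/-- **The inversion lifts**: `inv_mem` at the tautological point `φ_Z` of `Z_I` over `t_Z` gives `i : Z_I → Z_I` with
`i ≫ (Z_I ↪ G ×_S T) = (Z_I ↪ G ×_S T) ≫ ι_{G_T}` (`inv_pullback_obj_left_comp_fst` on the first projection, `Over.w` on the second).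
[cite: GortzWedhorn2020, Definition 4.42 and (4.15), pp. 116–117] -/
theorem exists_inv_lift_of_isSubgroupIdeal (hI : IsSubgroupIdeal G T I) :
    ∃ i : I.subscheme ⟶ I.subscheme, i ≫ I.subschemeι = I.subschemeι ≫ ι[(Over.pullback T.hom).obj G].left := by
  -- the tautological point of `Z_I`
  let Z : Over S := Over.mk (I.subschemeι ≫ (G ⊗ T).hom)
  let jZ : Z ⟶ G ⊗ T := Over.homMk I.subschemeι rfl
  have hZ : jZ ≫ fst G T ∈ pointsOver I (jZ ≫ snd G T) := by
    rw [mem_pointsOver_iff, ← comp_lift, lift_fst_snd, Category.comp_id]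
    change I ≤ I.subschemeι.ker
    rw [Scheme.IdealSheafData.ker_subschemeι]
  have h1 : I.subschemeι.ker ≤ (lift (jZ ≫ fst G T)⁻¹ (jZ ≫ snd G T)).left.ker := by
    rw [Scheme.IdealSheafData.ker_subschemeι]
    exact hI.inv_mem _ hZ
  refine ⟨IsClosedImmersion.lift I.subschemeι (lift (jZ ≫ fst G T)⁻¹ (jZ ≫ snd G T)).left h1, ?_⟩
  rw [IsClosedImmersion.lift_fac]
  apply pullback.hom_ext
  · rw [Category.assoc, inv_pullback_obj_left_comp_fst]
    change (lift (jZ ≫ fst G T)⁻¹ (jZ ≫ snd G T)).left ≫ (fst G T).left = jZ.left ≫ (fst G T).left ≫ ι[G].left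
    rw [← Over.comp_left, lift_fst, Hom.inv_def, Over.comp_left, Over.comp_left, Category.assoc]
  · have hw : ι[(Over.pullback T.hom).obj G].left ≫ pullback.snd G.hom T.hom = pullback.snd G.hom T.hom :=
      Over.w ι[(Over.pullback T.hom).obj G]
    rw [Category.assoc, hw]
    change (lift (jZ ≫ fst G T)⁻¹ (jZ ≫ snd G T)).left ≫ (snd G T).left = jZ.left ≫ (snd G T).left
    rw [← Over.comp_left, lift_snd, Over.comp_left]

/-- **The multiplication lifts**: `mul_mem` at the two projections of `Z_I ×_T Z_I` (read as points of `Z_I` over their common base)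
gives `m : Z_I ×_T Z_I → Z_I` with `m ≫ (Z_I ↪ G ×_S T) = ((Z_I ↪) ×_T (Z_I ↪)) ≫ μ_{G_T}` (★ `mul_pullback_obj_left_comp_fst` on the first
projection, `Over.w` on the second).  Here `Z_I ×_T Z_I` is Mathlib's `pullback f f` for the structure map `f : Z_I → T`, i.e. the
underlying scheme of `Over.mk f ⊗ Over.mk f`. [cite: GortzWedhorn2020, Definition 4.42 and (4.15), pp. 116–117]
[cite: GortzWedhorn2020, Section (4.7) (pp. 107–108)] -/
theorem exists_mul_lift_of_isSubgroupIdeal (hI : IsSubgroupIdeal G T I) :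
    ∃ m : pullback (I.subschemeι ≫ (snd G T).left) (I.subschemeι ≫ (snd G T).left) ⟶ I.subscheme,
      m ≫ I.subschemeι =
        ((Over.homMk (U := Over.mk (I.subschemeι ≫ (snd G T).left)) (V := (Over.pullback T.hom).obj G) I.subschemeι rfl) ⊗ₘ
            (Over.homMk (U := Over.mk (I.subschemeι ≫ (snd G T).left)) (V := (Over.pullback T.hom).obj G) I.subschemeι rfl)).left ≫
          μ[(Over.pullback T.hom).obj G].left := by
  -- the tautological point of `Z_I` and the two projections of `Z_I ×_T Z_I`, as `S`-morphisms
  let Z : Over S := Over.mk (I.subschemeι ≫ (G ⊗ T).hom)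
  let jZ : Z ⟶ G ⊗ T := Over.homMk I.subschemeι rfl
  let φZ : Z ⟶ G := jZ ≫ fst G T
  let tZ : Z ⟶ T := jZ ≫ snd G T
  have hZ : φZ ∈ pointsOver I tZ := by
    rw [mem_pointsOver_iff, ← comp_lift, lift_fst_snd, Category.comp_id]
    change I ≤ I.subschemeι.ker
    rw [Scheme.IdealSheafData.ker_subschemeι]
  let X : Over S := Over.mk (pullback.fst tZ.left tZ.left ≫ Z.hom)
  let k₁ : X ⟶ Z := Over.homMk (pullback.fst tZ.left tZ.left) rfl
  have hk₂w : pullback.snd tZ.left tZ.left ≫ Z.hom = X.hom := by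
    change pullback.snd tZ.left tZ.left ≫ Z.hom = pullback.fst tZ.left tZ.left ≫ Z.hom
    rw [← Over.w tZ, ← Category.assoc, ← pullback.condition, Category.assoc]
  let k₂ : X ⟶ Z := Over.homMk (pullback.snd tZ.left tZ.left) hk₂w
  have hk : k₁ ≫ tZ = k₂ ≫ tZ := by
    ext : 1
    exact pullback.condition
  -- both projections are points of `I` over the common base `k₁ ≫ t_Z`
  have h₁ : k₁ ≫ φZ ∈ pointsOver I (k₁ ≫ tZ) := comp_mem_pointsOver hZ k₁
  have h₂ : k₂ ≫ φZ ∈ pointsOver I (k₁ ≫ tZ) := by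
    rw [hk]
    exact comp_mem_pointsOver hZ k₂
  have hle : I.subschemeι.ker ≤ (lift ((k₁ ≫ φZ) * (k₂ ≫ φZ)) (k₁ ≫ tZ)).left.ker := by
    rw [Scheme.IdealSheafData.ker_subschemeι]
    exact hI.mul_mem _ h₁ h₂
  refine ⟨IsClosedImmersion.lift I.subschemeι (lift ((k₁ ≫ φZ) * (k₂ ≫ φZ)) (k₁ ≫ tZ)).left hle, ?_⟩
  rw [IsClosedImmersion.lift_fac]
  have w : pullback.fst G.hom T.hom ≫ G.hom = ((Over.pullback T.hom).obj G).hom ≫ T.hom := pullback.condition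
  apply pullback.hom_ext
  · -- first projection: `((k₁·φ_Z)(k₂·φ_Z), ·) ≫ pr_G = (pr₁ ≫ φ_Z) · (pr₂ ≫ φ_Z)` in `G` = the transported law read on `G`
    have lhs : (lift ((k₁ ≫ φZ) * (k₂ ≫ φZ)) (k₁ ≫ tZ)).left ≫ pullback.fst G.hom T.hom =
        pullback.lift (k₁ ≫ φZ).left (k₂ ≫ φZ).left
          ((Over.w (k₁ ≫ φZ)).trans (Over.w (k₂ ≫ φZ)).symm) ≫ μ[G].left := by
      change (lift ((k₁ ≫ φZ) * (k₂ ≫ φZ)) (k₁ ≫ tZ)).left ≫ (fst G T).left = _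
      rw [← Over.comp_left, lift_fst, Hom.mul_def, Over.comp_left, Over.lift_left]
    have rhs : (((Over.homMk (U := Over.mk (I.subschemeι ≫ (snd G T).left)) (V := (Over.pullback T.hom).obj G)
          I.subschemeι rfl) ⊗ₘ (Over.homMk (U := Over.mk (I.subschemeι ≫ (snd G T).left))
          (V := (Over.pullback T.hom).obj G) I.subschemeι rfl)).left ≫ μ[(Over.pullback T.hom).obj G].left) ≫
          pullback.fst G.hom T.hom =
        pullback.lift (k₁ ≫ φZ).left (k₂ ≫ φZ).left
          ((Over.w (k₁ ≫ φZ)).trans (Over.w (k₂ ≫ φZ)).symm) ≫ μ[G].left := by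
      rw [Category.assoc, mul_pullback_obj_left_comp_fst T.hom G w, ← Category.assoc]
      congr 1
      -- `(j ×_T j)` followed by the comparison `G_T ×_T G_T → G ×_S G` is `(pr₁ ≫ φ_Z, pr₂ ≫ φ_Z)`
      have e1 : ((Over.homMk (U := Over.mk (I.subschemeι ≫ (snd G T).left)) (V := (Over.pullback T.hom).obj G)
            I.subschemeι rfl) ⊗ₘ (Over.homMk (U := Over.mk (I.subschemeι ≫ (snd G T).left))
            (V := (Over.pullback T.hom).obj G) I.subschemeι rfl)).left ≫
            pullback.fst ((Over.pullback T.hom).obj G).hom ((Over.pullback T.hom).obj G).hom =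
          pullback.fst tZ.left tZ.left ≫ I.subschemeι := by
        rw [Over.tensorHom_left]
        exact pullback.lift_fst _ _ _
      have e2 : ((Over.homMk (U := Over.mk (I.subschemeι ≫ (snd G T).left)) (V := (Over.pullback T.hom).obj G)
            I.subschemeι rfl) ⊗ₘ (Over.homMk (U := Over.mk (I.subschemeι ≫ (snd G T).left))
            (V := (Over.pullback T.hom).obj G) I.subschemeι rfl)).left ≫
            pullback.snd ((Over.pullback T.hom).obj G).hom ((Over.pullback T.hom).obj G).hom =
          pullback.snd tZ.left tZ.left ≫ I.subschemeι := by
        rw [Over.tensorHom_left]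
        exact pullback.lift_snd _ _ _
      have m1 : pullback.map ((Over.pullback T.hom).obj G).hom ((Over.pullback T.hom).obj G).hom G.hom G.hom
            (pullback.fst G.hom T.hom) (pullback.fst G.hom T.hom) T.hom w.symm w.symm ≫ pullback.fst G.hom G.hom =
          pullback.fst _ _ ≫ pullback.fst G.hom T.hom := pullback.lift_fst _ _ _
      have m2 : pullback.map ((Over.pullback T.hom).obj G).hom ((Over.pullback T.hom).obj G).hom G.hom G.hom
            (pullback.fst G.hom T.hom) (pullback.fst G.hom T.hom) T.hom w.symm w.symm ≫ pullback.snd G.hom G.hom =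
          pullback.snd _ _ ≫ pullback.fst G.hom T.hom := pullback.lift_snd _ _ _
      apply pullback.hom_ext
      · rw [pullback.lift_fst]
        simp only [Category.assoc]
        rw [m1, ← Category.assoc, e1, Category.assoc]
        rfl
      · rw [pullback.lift_snd]
        simp only [Category.assoc]
        rw [m2, ← Category.assoc, e2, Category.assoc]
        rfl
    exact lhs.trans rhs.symm
  · -- second projection: both sides lie over `T` through the first projection of `Z_I ×_T Z_I`
    have hw : μ[(Over.pullback T.hom).obj G].left ≫ pullback.snd G.hom T.hom =
        (((Over.pullback T.hom).obj G) ⊗ ((Over.pullback T.hom).obj G)).hom := Over.w μ[(Over.pullback T.hom).obj G]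
    have lhs : (lift ((k₁ ≫ φZ) * (k₂ ≫ φZ)) (k₁ ≫ tZ)).left ≫ pullback.snd G.hom T.hom = (k₁ ≫ tZ).left := by
      change (lift ((k₁ ≫ φZ) * (k₂ ≫ φZ)) (k₁ ≫ tZ)).left ≫ (snd G T).left = _
      rw [← Over.comp_left, lift_snd]
    have rhs : (((Over.homMk (U := Over.mk (I.subschemeι ≫ (snd G T).left)) (V := (Over.pullback T.hom).obj G)
          I.subschemeι rfl) ⊗ₘ (Over.homMk (U := Over.mk (I.subschemeι ≫ (snd G T).left))
          (V := (Over.pullback T.hom).obj G) I.subschemeι rfl)).left ≫ μ[(Over.pullback T.hom).obj G].left) ≫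
          pullback.snd G.hom T.hom = (k₁ ≫ tZ).left := by
      rw [Category.assoc, hw, Over.w]
      rfl
    exact lhs.trans rhs.symm

/-! ## §3 The closed subgroup scheme `Z_I ≤ G_T` -/

/-- **A subgroup ideal defines a closed subgroup SCHEME of `G_T` over `T`.**  For `I` an ideal sheaf of `G ×_S T` with
`IsSubgroupIdeal G T I` (★ file 1: the points of `Z_I` over every `t : W ⟶ T` form a subgroup of `G(W)`), the `T`-scheme
`Z_I → T` (`Over.mk (Z_I ↪ G ×_S T → T)`) carries a group-scheme structure for which the closed immersion `Z_I ↪ G_T` into the base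
change `G_T = (T → S)^* G` (Mathlib `Over.pullback`, transported structure `Functor.grpObjObj`) is a HOMOMORPHISM of `T`-group schemes
— i.e. the datum `(C, grpObj, j, isMonHom, isClosedImmersion)` of the kit carrier `SubgroupSchemeDatum T G_T`.  With
`I ∈ stableSubgroupFunctorOfPoints q G act T` this is Liu's «finite flat `T`-subgroup of rank `q`» as an honest subgroup scheme.
[cite: GortzWedhorn2020, Definition 4.42 and (4.15), pp. 116–117] [cite: MumfordFogartyKirwan1994, Ch. 0 §1 (p. 2)]
[cite: Liu2021, Appendix D, p. 137 L7–11] -/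
theorem exists_grpObj_isMonHom_of_isSubgroupIdeal (hI : IsSubgroupIdeal G T I) :
    ∃ GU : GrpObj (Over.mk (I.subschemeι ≫ (snd G T).left) : Over T.left),
      letI := GU
      IsMonHom (Over.homMk (U := Over.mk (I.subschemeι ≫ (snd G T).left)) (V := (Over.pullback T.hom).obj G)
        I.subschemeι rfl) := by
  let U : Over T.left := Over.mk (I.subschemeι ≫ (snd G T).left)
  let X : Over T.left := (Over.pullback T.hom).obj G
  let j : U ⟶ X := Over.homMk (U := U) (V := X) I.subschemeι rfl
  haveI : Mono j := (Over.forget T.left).mono_of_mono_map (show Mono I.subschemeι from inferInstance)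
  obtain ⟨e, he⟩ := exists_one_lift_of_isSubgroupIdeal hI
  obtain ⟨i, hi⟩ := exists_inv_lift_of_isSubgroupIdeal hI
  obtain ⟨m, hm⟩ := exists_mul_lift_of_isSubgroupIdeal hI
  -- the three lifts as `T`-morphisms
  have hew : e ≫ U.hom = (𝟙_ (Over T.left)).hom := by
    change e ≫ I.subschemeι ≫ (snd G T).left = 𝟙 T.left
    rw [← Category.assoc, he]
    exact Over.w η[(Over.pullback T.hom).obj G]
  let eU : 𝟙_ (Over T.left) ⟶ U := Over.homMk (U := 𝟙_ (Over T.left)) (V := U) e hew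
  have hiw : i ≫ U.hom = U.hom := by
    change i ≫ I.subschemeι ≫ (snd G T).left = I.subschemeι ≫ (snd G T).left
    rw [← Category.assoc, hi, Category.assoc]
    congr 1
    exact Over.w ι[(Over.pullback T.hom).obj G]
  let iU : U ⟶ U := Over.homMk (U := U) (V := U) i hiw
  have hmw : m ≫ U.hom = (U ⊗ U).hom := by
    change m ≫ I.subschemeι ≫ (snd G T).left = (U ⊗ U).hom
    rw [← Category.assoc, hm, Category.assoc]
    have h1 : μ[(Over.pullback T.hom).obj G].left ≫ (snd G T).left = (X ⊗ X).hom := Over.w μ[(Over.pullback T.hom).obj G]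
    rw [h1]
    exact Over.w (j ⊗ₘ j)
  let mU : U ⊗ U ⟶ U := Over.homMk (U := U ⊗ U) (V := U) m hmw
  obtain ⟨GU, -, -, -, hhom⟩ := exists_grpObj_isMonHom_of_lifts j mU (Over.OverMorphism.ext hm) eU
    (Over.OverMorphism.ext he) iU (Over.OverMorphism.ext hi)
  exact ⟨GU, hhom⟩

end Scheme

end Literature.AlgebraicGeometry.GroupSchemes

end
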